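import Summits.BirchSwinnertonDyer.BirchSwinnertonDyer.Theorems.PrintCf2RamifiedOffTYZLowerHalfVisibleSeven
import HarnessLib

/-!
# Route `PrintCf2`, crux stmt-BirchSwinnertonDyer-20509 `RamifiedOffTYZOfFacts` — the lower half of C⁺ on VISIBLE special generators of the
# block-free family, with the TYZ display as an EXPLICIT PER-`n` HYPOTHESIS (no `cite_only` named fact in the antecedent)
# (cell `bsd-print-cf2`, LEAD of 20509 g17, line `offtyz-v7`, lineage cycle 18; Theses-free, no `def`)

HONEST FRAMING.  g16's theorem `LowerHalfVisible.two_dvd_scriptL_of_visible_of_facts` (p760160) takes the named fact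
`tyz_cmPointCompositumData` (TYZ 2017 §3 displays including the compositum sentence "`ℍ′_n := L_n(i)·∏ H′_{d₀}`", p759295) as antecedent;
the route walker flags that fact `cite_only` (not yet promoted), so the planner's aside `RamifiedLowerHalfVisibleSevenOfFacts` (route A rev 54)
had to be dropped at rev 55 (planner g22, STATUS 2026-08-30T04:31:17Z).  This file restates the SAME result with the display data as an explicit
hypothesis AT THE GIVEN `n` — `∃ D : GenusPointData n, D.Printed ∧ D.CMPointCompositumPrinted`, which is `tyz_cmPointCompositumData`
specialised to `n` and nothing more — and Gross–Zagier–Kolyvagin (`rank_eq_analyticRank_of_analyticRank_le_one`, conjunct 1 of 𝔅_ram) as the only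
named fact.  It is a one-line wrapper of g16's `two_dvd_scriptL_of_visible_of_displays`; nothing new is claimed mathematically.  Purpose: a
by-name closable aside text whose antecedent is promotion-independent (§2 is the exact text).  Nothing about BSD is asserted; C⁺ = item
stmt-BirchSwinnertonDyer-23431 stays OPEN; BSD is not proved by any of this.

References: [TianYuanZhang2017] §1 (p0002 L101–L110), §3.1 (p0011 L27–L36, L58–L66), Prop. 3.2 (3), Thm. 3.5, Lemma 3.18; [Darmon2004] Thm. 3.22 (GZK).
-/

noncomputable section

open WeierstrassCurve WeierstrassCurve.Affine Literature.NumberTheory.EllipticCurves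
  Literature.NumberTheory.EllipticCurves.TianYuanZhang2017

namespace Summit.BirchSwinnertonDyer.PrintCf2.LowerHalfVisible

/-- **The lower half of C⁺ on visible special generators of the block-free family, display as hypothesis.**  For square-free `n ≡ 7 (mod 8)`
with no divisor `≡ 5 (mod 8)`, GIVEN TYZ's §3 data at `n` with the compositum sentence (`∃ D : GenusPointData n, D.Printed ∧
D.CMPointCompositumPrinted`), `ord_{s=1} L(E_n, s) = 1`, and a generator `h = (X, Y)` of `A_n(ℚ)` modulo torsion
(`A_n = (congruentNumberCurve n).twoIsogenyCodomain : Y² = X³ + 4n²X`) with `X ∉ ℚ^{×2} ∪ 2ℚ^{×2}`: every integer `L` with `𝓛(n)² = L²` is EVEN.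
Granted GZK only. [cite: TianYuanZhang2017, §1 (p0002 L101–L110), §3.1 (p0011 L58–L66), Thm. 3.5, Lemma 3.18] [cite: Darmon2004, Thm. 3.22] -/
theorem two_dvd_scriptL_of_visible_of_display :
    rank_eq_analyticRank_of_analyticRank_le_one →
      ∀ n : ℕ, (hsq : Squarefree n) → n % 8 = 7 → (∀ d ∈ n.divisors, d % 8 ≠ 5) →
        (∃ D : GenusPointData n, D.Printed ∧ D.CMPointCompositumPrinted) →
        (haveI := isElliptic_congruentNumberCurve hsq.ne_zero; (congruentNumberCurve n).analyticRank = 1) →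
        ∀ (X Y : ℚ) (h : ((congruentNumberCurve n).twoIsogenyCodomain).toAffine.Nonsingular X Y),
          (∀ P, ∃ m : ℤ, IsOfFinAddOrder
              (P - m • (Point.some X Y h : ((congruentNumberCurve n).twoIsogenyCodomain).toAffine.Point))) →
          (¬ ∃ q : ℚ, X = q ^ 2 ∨ X = 2 * q ^ 2) →
            ∀ L : ℤ, IsScriptL n L → (2 : ℤ) ∣ L := by
  intro hGZK n hsq h7 hnb hD hr X Y h hgen hX L hL
  obtain ⟨D, hPr, hC⟩ := hD
  exact two_dvd_scriptL_of_visible_of_displays hGZK hsq h7 hnb hr D hPr hC h hgen hX hL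

end Summit.BirchSwinnertonDyer.PrintCf2.LowerHalfVisible

end
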